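import Literature.NumberTheory.LFunctions.EntireZeroSum
import HarnessLib

/-!
# Tails of zero sums: `Σ_{|γ| ≥ T} m(ρ)/|ρ|² ≤ T^{−1/2} · W (c₁ A + c₂)` from a window bound

Topic `Literature/NumberTheory/LFunctions`, sub-namespace `EntireEF`. Everything here is PROVED.

For an entire `f` whose non-trivial zeros obey the window bound
`Σ_{window at τ} m ≤ W (A + log(|τ| + 4))` (as the tree provides for Dirichlet `L`-functions and
`ClassGroupLFunctionWindows` for `L₀(s, χ)`, `ζ_K`), the zeros with `|γ| ≥ 1` satisfy

* `summable_mul_rpow_neg` — `Σ_ρ m(ρ) |γ|^{−3/2} 𝟙_{|γ| ≥ 1} ≤ W (c₁ A + c₂)` with the ABSOLUTE constants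
  `c₁ = 16 Σ_{k ≥ 1} k^{−3/2}`, `c₂ = 16 Σ_{k ≥ 1} log(k + 5) k^{−3/2}` (`tailConst₁`, `tailConst₂`);
* `tsum_tail_div_normSq_le` — **`Σ_{|γ| ≥ T} m(ρ)/‖ρ‖² ≤ T^{−1/2} W (c₁ A + c₂)`** for `T ≥ 1`
  (`‖ρ‖² ≥ |γ|² = |γ|^{1/2} |γ|^{3/2} ≥ T^{1/2} |γ|^{3/2}`).

This is the "zeros of large height" step of smoothed explicit formulae with an order-`2` decaying test
transform (Thorner–Zaman 2019, Lemma 4.5, the blocks `T_j ≥ T₁`, here by the crude count).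

## References

* J. Thorner, A. Zaman, ANT 13 (2019), Lemma 4.5. [ThornerZaman2019]
* H. L. Montgomery, R. C. Vaughan, *Multiplicative Number Theory I*, Thm. 10.17. [MontgomeryVaughan2007]
-/

noncomputable section

open Complex Filter Topology Set Finset

namespace Literature.NumberTheory.LFunctions.EntireEF

variable {f : ℂ → ℂ}

/-! ### The absolute constants -/

/-- `c₁ = 16 Σ_{k ≥ 1} k^{−3/2}` (as a convergent series; `k = 0` contributes `0`). [folklore] -/
def tailConst₁ : ℝ := 16 * ∑' k : ℕ, (1 : ℝ) / (k : ℝ) ^ ((3 : ℝ) / 2)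

/-- `c₂ = 16 Σ_{k ≥ 0} log(k + 5) (k+1)^{−3/2}`. [folklore] -/
def tailConst₂ : ℝ := 16 * ∑' k : ℕ, Real.log ((k : ℝ) + 5) / ((k : ℝ) + 1) ^ ((3 : ℝ) / 2)

/-- The series defining `c₁` converges. [folklore] -/
theorem summable_tailConst₁ : Summable fun k : ℕ ↦ (1 : ℝ) / (k : ℝ) ^ ((3 : ℝ) / 2) :=
  Real.summable_one_div_nat_rpow.2 (by norm_num)

/-- `log(k+5) ≤ 4 (k+1)^{1/4}`. [folklore] -/
theorem log_add_five_le (k : ℕ) : Real.log ((k : ℝ) + 5) ≤ 4 * ((k : ℝ) + 1) ^ ((1 : ℝ) / 4) := by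
  have hk : (0 : ℝ) ≤ k := Nat.cast_nonneg k
  have h1 : Real.log ((k : ℝ) + 5) ≤ Real.log (5 * ((k : ℝ) + 1)) := Real.log_le_log (by linarith) (by linarith)
  rw [Real.log_mul (by norm_num) (by linarith)] at h1
  -- `log y ≤ 4 (y^{1/4} - 1)` i.e. `log(y^{1/4}) ≤ y^{1/4} - 1`
  set y : ℝ := (k : ℝ) + 1 with hy
  have hy1 : 1 ≤ y := by rw [hy]; linarith
  have hroot : 0 < y ^ ((1 : ℝ) / 4) := Real.rpow_pos_of_pos (by linarith) _
  have h2 : Real.log y = 4 * Real.log (y ^ ((1 : ℝ) / 4)) := by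
    rw [Real.log_rpow (by linarith)]; ring
  have h3 : Real.log (y ^ ((1 : ℝ) / 4)) ≤ y ^ ((1 : ℝ) / 4) - 1 := Real.log_le_sub_one_of_pos hroot
  have h5 : Real.log 5 ≤ 2 := by
    have : Real.log 5 ≤ Real.log (Real.exp 2) := by
      refine Real.log_le_log (by norm_num) ?_
      have := Real.exp_one_gt_d9
      have h : Real.exp 2 = Real.exp 1 * Real.exp 1 := by rw [← Real.exp_add]; norm_num
      rw [h]; nlinarith
    rwa [Real.log_exp] at this
  have h1r : 1 ≤ y ^ ((1 : ℝ) / 4) := Real.one_le_rpow hy1 (by norm_num)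
  nlinarith

/-- The series defining `c₂` converges. [folklore] -/
theorem summable_tailConst₂ : Summable fun k : ℕ ↦ Real.log ((k : ℝ) + 5) / ((k : ℝ) + 1) ^ ((3 : ℝ) / 2) := by
  have hmaj : Summable fun k : ℕ ↦ 4 * ((k : ℝ) + 1) ^ (-((5 : ℝ) / 4)) := by
    have h := (summable_nat_add_iff 1).2 (Real.summable_nat_rpow.2 (by norm_num : -((5 : ℝ) / 4) < -1))
    refine (h.congr fun k ↦ ?_).mul_left 4
    simp
  refine Summable.of_nonneg_of_le (fun k ↦ ?_) (fun k ↦ ?_) hmaj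
  · exact div_nonneg (Real.log_nonneg (by linarith [(Nat.cast_nonneg k : (0:ℝ) ≤ k)])) (by positivity)
  · have hk1 : (0 : ℝ) < (k : ℝ) + 1 := by positivity
    rw [div_le_iff₀ (by positivity)]
    calc Real.log ((k : ℝ) + 5) ≤ 4 * ((k : ℝ) + 1) ^ ((1 : ℝ) / 4) := log_add_five_le k
      _ = 4 * ((k : ℝ) + 1) ^ (-((5 : ℝ) / 4)) * ((k : ℝ) + 1) ^ ((3 : ℝ) / 2) := by
          rw [mul_assoc, ← Real.rpow_add hk1]; norm_num

/-- `c₁ ≥ 16` and `c₂ ≥ 0`. [folklore] -/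
theorem tailConst_nonneg : 16 ≤ tailConst₁ ∧ 0 ≤ tailConst₂ := by
  constructor
  · rw [tailConst₁]
    have h : (1 : ℝ) ≤ ∑' k : ℕ, (1 : ℝ) / (k : ℝ) ^ ((3 : ℝ) / 2) := by
      have := summable_tailConst₁.le_tsum 1 (fun k _ ↦ by positivity)
      simpa using this
    linarith
  · rw [tailConst₂]
    exact mul_nonneg (by norm_num) (tsum_nonneg fun k ↦ div_nonneg
      (Real.log_nonneg (by linarith [(Nat.cast_nonneg k : (0:ℝ) ≤ k)])) (by positivity))

/-! ### The weighted count `Σ m(ρ) |γ|^{−3/2} 𝟙_{|γ| ≥ 1}` -/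

/-- `round |γ| = n ≥ 1` puts `γ` in the window at `n` or at `−n`, and `|γ| ≥ n/2`. [folklore] -/
theorem window_of_round {γ : ℝ} {n : ℕ} (hn : round |γ| = (n : ℤ)) (hγ : 1 ≤ |γ|) :
    (|γ - n| ≤ 1 / 2 ∨ |γ - -(n : ℝ)| ≤ 1 / 2) ∧ (n : ℝ) / 2 ≤ |γ| ∧ 1 ≤ n := by
  have h1 : abs (|γ| - round |γ|) ≤ 1 / 2 := abs_sub_round |γ|
  rw [hn] at h1
  push_cast at h1
  have hn1 : (1 : ℝ) ≤ n := by
    have := abs_le.1 h1; 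
    by_contra hlt; rw [not_le] at hlt
    have : (n : ℝ) ≤ 0 := by
      have : n < 1 := by exact_mod_cast hlt
      interval_cases n; simp
    linarith [this, abs_le.1 h1]
  refine ⟨?_, by linarith [abs_le.1 h1], by exact_mod_cast hn1⟩
  rcases le_or_gt 0 γ with h | h
  · left; rw [abs_of_nonneg h] at h1; exact h1
  · right
    rw [abs_of_neg h] at h1
    rw [show γ - -(n : ℝ) = -(-γ - n) by ring, abs_neg]
    exact h1

/-- **`Σ_ρ m(ρ) 𝟙_{|γ| ≥ 1} |γ|^{−3/2} ≤ W (c₁ A + c₂)`** over the non-trivial zeros of `f`, from the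
window bound (grouping by `n = round|γ| ≥ 1`: the fibre lies in the windows at `±n`, weighs
`≤ 2W(A + log(n + 4))`, and `|γ|^{−3/2} ≤ (n/2)^{−3/2} ≤ 4 n^{−3/2}`). [cite: MontgomeryVaughan2007, Theorem 10.17] -/
theorem summable_indicator_mul_rpow {W A : ℝ} (hW : 0 ≤ W) (hA : 0 ≤ A)
    (hwin : ∀ (τ : ℝ) (P : Finset ℂ), (∀ ρ ∈ P, f ρ = 0 ∧ 0 < ρ.re ∧ ρ.re < 1 ∧ |ρ.im - τ| ≤ 1 / 2) →
      ∑ ρ ∈ P, (analyticOrderNatAt f ρ : ℝ) ≤ W * (A + Real.log (|τ| + 4))) :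
    Summable (fun ρ : nontrivialZeros f ↦
        (if 1 ≤ |(ρ : ℂ).im| then (analyticOrderNatAt f (ρ : ℂ) : ℝ) * |(ρ : ℂ).im| ^ (-((3 : ℝ) / 2)) else 0)) ∧
      ∑' ρ : nontrivialZeros f,
        (if 1 ≤ |(ρ : ℂ).im| then (analyticOrderNatAt f (ρ : ℂ) : ℝ) * |(ρ : ℂ).im| ^ (-((3 : ℝ) / 2)) else 0) ≤
          W * (tailConst₁ * A + tailConst₂) := by
  classical
  set F : nontrivialZeros f → ℝ := fun ρ ↦
    if 1 ≤ |(ρ : ℂ).im| then (analyticOrderNatAt f (ρ : ℂ) : ℝ) * |(ρ : ℂ).im| ^ (-((3 : ℝ) / 2)) else 0 with hF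
  have hF0 : ∀ ρ, 0 ≤ F ρ := fun ρ ↦ by
    rw [hF]; dsimp only; split_ifs
    · positivity
    · exact le_rfl
  -- the majorant over `n : ℕ`
  set g : ℕ → ℝ := fun n ↦ 8 * W * ((A + Real.log ((n : ℝ) + 4)) * (1 / (n : ℝ) ^ ((3 : ℝ) / 2))) with hg
  have hg0 : ∀ n, 0 ≤ g n := fun n ↦ by
    have : 0 ≤ Real.log ((n : ℝ) + 4) := Real.log_nonneg (by linarith [(Nat.cast_nonneg n : (0:ℝ) ≤ n)])
    rw [hg]; positivity
  -- `Σ g ≤ W (c₁ A + c₂)` (with `g 0 = 0` since `0^{3/2} = 0`)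
  have hgsum : Summable g ∧ ∑' n, g n ≤ W * (tailConst₁ * A + tailConst₂) := by
    have h1 : Summable fun n : ℕ ↦ 8 * W * A * ((1 : ℝ) / (n : ℝ) ^ ((3 : ℝ) / 2)) := summable_tailConst₁.mul_left _
    -- the log part, shifted: `log(n+4)/n^{3/2}` for `n ≥ 1` is `log(j+5)/(j+1)^{3/2}`
    set ℓ : ℕ → ℝ := fun n ↦ Real.log ((n : ℝ) + 4) * (1 / (n : ℝ) ^ ((3 : ℝ) / 2)) with hℓ
    have hℓ0 : ℓ 0 = 0 := by simp [hℓ, Real.zero_rpow (by norm_num : ((3:ℝ)/2) ≠ 0)]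
    have hℓshift : ∀ j : ℕ, ℓ (j + 1) = Real.log ((j : ℝ) + 5) / ((j : ℝ) + 1) ^ ((3 : ℝ) / 2) := by
      intro j; simp only [hℓ]; push_cast; rw [show (j : ℝ) + 1 + 4 = (j : ℝ) + 5 by ring]; ring
    have hℓsum : Summable ℓ := by
      rw [← summable_nat_add_iff 1]
      exact summable_tailConst₂.congr fun j ↦ (hℓshift j).symm
    have hℓval : ∑' n, ℓ n = ∑' j : ℕ, Real.log ((j : ℝ) + 5) / ((j : ℝ) + 1) ^ ((3 : ℝ) / 2) := by
      rw [hℓsum.tsum_eq_zero_add, hℓ0, zero_add]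
      exact tsum_congr hℓshift
    have h2 : Summable fun n : ℕ ↦ 8 * W * ℓ n := hℓsum.mul_left _
    have hsum : Summable g := by
      refine (h1.add h2).congr fun n ↦ ?_
      simp only [hg, hℓ]; ring
    refine ⟨hsum, ?_⟩
    have hval : ∑' n, g n = 8 * W * A * (∑' n : ℕ, (1 : ℝ) / (n : ℝ) ^ ((3 : ℝ) / 2)) + 8 * W * ∑' n, ℓ n := by
      rw [← tsum_mul_left, ← tsum_mul_left, ← h1.tsum_add h2]
      exact tsum_congr fun n ↦ by simp only [hg, hℓ]; ring
    rw [hval, hℓval, tailConst₁, tailConst₂]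
    have hp1 : 0 ≤ ∑' n : ℕ, (1 : ℝ) / (n : ℝ) ^ ((3 : ℝ) / 2) := tsum_nonneg fun n ↦ by positivity
    have hp2 : 0 ≤ ∑' j : ℕ, Real.log ((j : ℝ) + 5) / ((j : ℝ) + 1) ^ ((3 : ℝ) / 2) := tsum_nonneg fun k ↦ div_nonneg
      (Real.log_nonneg (by linarith [(Nat.cast_nonneg k : (0:ℝ) ≤ k)])) (by positivity)
    nlinarith [mul_nonneg hW hp1, mul_nonneg hW hp2, mul_nonneg (mul_nonneg hW hA) hp1]
  -- partial sums of `F` are `≤ Σ' g`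
  have hpartial : ∀ u : Finset (nontrivialZeros f), ∑ ρ ∈ u, F ρ ≤ ∑' n, g n := by
    intro u
    set kf : nontrivialZeros f → ℕ := fun ρ ↦ (round |(ρ : ℂ).im|).toNat with hkf
    rw [← Finset.sum_fiberwise_of_maps_to (g := kf) (fun ρ _ ↦ Finset.mem_image_of_mem kf ‹_›)]
    refine (Finset.sum_le_sum fun n hn ↦ ?_).trans (hgsum.1.sum_le_tsum _ (fun n _ ↦ hg0 n))
    -- the fibre at `n`
    by_cases hn0 : n = 0
    · -- zeros with `round|γ| ≤ 0`, i.e. `|γ| < 1/2 < 1`: `F = 0`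
      subst hn0
      refine le_trans (Finset.sum_nonpos fun ρ hρ ↦ ?_) (hg0 0)
      rw [Finset.mem_filter] at hρ
      have hr : round |(ρ : ℂ).im| ≤ 0 := by
        have := hρ.2; rw [hkf] at this; dsimp only at this
        exact Int.toNat_eq_zero.1 this
      have hlt : |(ρ : ℂ).im| < 1 := by
        have h1 := abs_sub_round |(ρ : ℂ).im|
        have h2 : (round |(ρ : ℂ).im| : ℝ) ≤ 0 := by exact_mod_cast hr
        linarith [abs_le.1 h1]
      rw [hF]; dsimp only; rw [if_neg (not_le.2 hlt)]
    · have hnpos : 1 ≤ n := Nat.one_le_iff_ne_zero.2 hn0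
      have hnR : (1 : ℝ) ≤ n := by exact_mod_cast hnpos
      -- in the fibre, `round|γ| = n`
      have hfib : ∀ ρ ∈ u.filter (fun ρ ↦ kf ρ = n), round |(ρ : ℂ).im| = (n : ℤ) := by
        intro ρ hρ
        have h := (Finset.mem_filter.1 hρ).2
        rw [hkf] at h; dsimp only at h
        have hnn : 0 ≤ round |(ρ : ℂ).im| := by
          rw [round_eq]; exact Int.floor_nonneg.2 (by linarith [abs_nonneg ((ρ : ℂ).im)])
        rw [← h, Int.toNat_of_nonneg hnn]
      -- pointwise: `F ρ ≤ 4 n^{-3/2} m(ρ) 𝟙_{|γ| ≥ 1}`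
      set Pf := u.filter (fun ρ ↦ kf ρ = n) with hPf
      set Pplus : Finset ℂ := (Pf.filter (fun ρ : nontrivialZeros f ↦ 1 ≤ |(ρ : ℂ).im| ∧ |(ρ : ℂ).im - n| ≤ 1 / 2)).image Subtype.val with hPplus
      set Pminus : Finset ℂ := (Pf.filter (fun ρ : nontrivialZeros f ↦ 1 ≤ |(ρ : ℂ).im| ∧ ¬ |(ρ : ℂ).im - n| ≤ 1 / 2)).image Subtype.val with hPminus
      have hwplus : ∑ ρ ∈ Pplus, (analyticOrderNatAt f ρ : ℝ) ≤ W * (A + Real.log ((n : ℝ) + 4)) := by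
        have := hwin (n : ℝ) Pplus (fun z hz ↦ by
          obtain ⟨ρ, hρ, rfl⟩ := Finset.mem_image.1 hz
          have h2 := (Finset.mem_filter.1 hρ).2
          exact ⟨ρ.2.1, ρ.2.2.1, ρ.2.2.2, h2.2⟩)
        rwa [show |(n : ℝ)| = n from abs_of_nonneg (by linarith)] at this
      have hwminus : ∑ ρ ∈ Pminus, (analyticOrderNatAt f ρ : ℝ) ≤ W * (A + Real.log ((n : ℝ) + 4)) := by
        have := hwin (-(n : ℝ)) Pminus (fun z hz ↦ by
          obtain ⟨ρ, hρ, rfl⟩ := Finset.mem_image.1 hz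
          have h1 := (Finset.mem_filter.1 hρ)
          have h2 := h1.2
          have hr := hfib ρ h1.1
          rcases (window_of_round hr h2.1).1 with h | h
          · exact absurd h h2.2
          · exact ⟨ρ.2.1, ρ.2.2.1, ρ.2.2.2, h⟩)
        rwa [abs_neg, show |(n : ℝ)| = n from abs_of_nonneg (by linarith)] at this
      have hpt : ∀ ρ ∈ Pf, F ρ ≤ 4 * (1 / (n : ℝ) ^ ((3 : ℝ) / 2)) *
          ((if 1 ≤ |(ρ : ℂ).im| ∧ |(ρ : ℂ).im - n| ≤ 1 / 2 then (analyticOrderNatAt f (ρ : ℂ) : ℝ) else 0) +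
           (if 1 ≤ |(ρ : ℂ).im| ∧ ¬ |(ρ : ℂ).im - n| ≤ 1 / 2 then (analyticOrderNatAt f (ρ : ℂ) : ℝ) else 0)) := by
        intro ρ hρ
        rw [hF]; dsimp only
        by_cases h1 : 1 ≤ |(ρ : ℂ).im|
        · rw [if_pos h1]
          obtain ⟨-, hγn, -⟩ := window_of_round (hfib ρ hρ) h1
          have hm : (0 : ℝ) ≤ analyticOrderNatAt f (ρ : ℂ) := Nat.cast_nonneg _
          have hpow : |(ρ : ℂ).im| ^ (-((3 : ℝ) / 2)) ≤ 4 * (1 / (n : ℝ) ^ ((3 : ℝ) / 2)) := by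
            have hγpos : 0 < |(ρ : ℂ).im| := by linarith
            rw [Real.rpow_neg hγpos.le, ← one_div]
            -- `(n/2)^{3/2} ≤ |γ|^{3/2}` and `n^{3/2} = 2^{3/2} (n/2)^{3/2} ≤ 4 (n/2)^{3/2}`
            have h3 : ((n : ℝ) / 2) ^ ((3 : ℝ) / 2) ≤ |(ρ : ℂ).im| ^ ((3 : ℝ) / 2) :=
              Real.rpow_le_rpow (by positivity) hγn (by norm_num)
            have h4 : (n : ℝ) ^ ((3 : ℝ) / 2) = (2 : ℝ) ^ ((3 : ℝ) / 2) * ((n : ℝ) / 2) ^ ((3 : ℝ) / 2) := by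
              rw [← Real.mul_rpow (by norm_num) (by positivity)]; congr 1; ring
            have h22 : (2 : ℝ) ^ ((3 : ℝ) / 2) ≤ 4 := by
              have : (2 : ℝ) ^ ((3 : ℝ) / 2) ≤ (2 : ℝ) ^ ((2 : ℝ)) := Real.rpow_le_rpow_of_exponent_le (by norm_num) (by norm_num)
              norm_num at this; exact this
            have hpos : 0 < ((n : ℝ) / 2) ^ ((3 : ℝ) / 2) := Real.rpow_pos_of_pos (by positivity) _
            have hnpow : 0 < (n : ℝ) ^ ((3 : ℝ) / 2) := Real.rpow_pos_of_pos (by positivity) _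
            calc 1 / |(ρ : ℂ).im| ^ ((3 : ℝ) / 2) ≤ 1 / ((n : ℝ) / 2) ^ ((3 : ℝ) / 2) := one_div_le_one_div_of_le hpos h3
              _ = (2 : ℝ) ^ ((3 : ℝ) / 2) * (1 / (n : ℝ) ^ ((3 : ℝ) / 2)) := by rw [h4]; field_simp
              _ ≤ 4 * (1 / (n : ℝ) ^ ((3 : ℝ) / 2)) := mul_le_mul_of_nonneg_right h22 (by positivity)
          by_cases h2 : |(ρ : ℂ).im - n| ≤ 1 / 2
          · rw [if_pos ⟨h1, h2⟩, if_neg (fun h ↦ h.2 h2), add_zero, mul_comm]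
            exact mul_le_mul_of_nonneg_right hpow hm
          · rw [if_neg (fun h ↦ h2 h.2), if_pos ⟨h1, h2⟩, zero_add, mul_comm]
            exact mul_le_mul_of_nonneg_right hpow hm
        · rw [if_neg h1, if_neg (fun h ↦ h1 h.1), if_neg (fun h ↦ h1 h.1), add_zero, mul_zero]
      refine (Finset.sum_le_sum hpt).trans ?_
      rw [← Finset.mul_sum, Finset.sum_add_distrib, ← Finset.sum_filter, ← Finset.sum_filter]
      have eplus : ∑ ρ ∈ Pf.filter (fun ρ : nontrivialZeros f ↦ 1 ≤ |(ρ : ℂ).im| ∧ |(ρ : ℂ).im - n| ≤ 1 / 2), (analyticOrderNatAt f (ρ : ℂ) : ℝ) =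
          ∑ ρ ∈ Pplus, (analyticOrderNatAt f ρ : ℝ) := by
        rw [hPplus, Finset.sum_image (fun a _ b _ h ↦ Subtype.ext h)]
      have eminus : ∑ ρ ∈ Pf.filter (fun ρ : nontrivialZeros f ↦ 1 ≤ |(ρ : ℂ).im| ∧ ¬ |(ρ : ℂ).im - n| ≤ 1 / 2), (analyticOrderNatAt f (ρ : ℂ) : ℝ) =
          ∑ ρ ∈ Pminus, (analyticOrderNatAt f ρ : ℝ) := by
        rw [hPminus, Finset.sum_image (fun a _ b _ h ↦ Subtype.ext h)]
      rw [eplus, eminus, hg]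
      have hlog : 0 ≤ Real.log ((n : ℝ) + 4) := Real.log_nonneg (by linarith)
      have hinv : 0 ≤ 1 / (n : ℝ) ^ ((3 : ℝ) / 2) := by positivity
      nlinarith [mul_nonneg hinv (by positivity : (0:ℝ) ≤ W * (A + Real.log ((n : ℝ) + 4)))]
  have hsum : Summable F := summable_of_sum_le hF0 hpartial
  exact ⟨hsum, (hsum.tsum_le_of_sum_le hpartial).trans hgsum.2⟩

/-! ### The tail `Σ_{|γ| ≥ T} m(ρ)/‖ρ‖²` -/

/-- **`Σ_{|γ| ≥ T} m(ρ)/‖ρ‖² ≤ T^{−1/2} · W (c₁ A + c₂)`** for `T ≥ 1`, over the non-trivial zeros of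
`f` (`‖ρ‖² ≥ γ² ≥ T^{1/2} |γ|^{3/2}`), together with the summability of the tail.
[cite: ThornerZaman2019, Lemma 4.5 (zeros of large height)] -/
theorem tsum_tail_div_normSq_le {W A : ℝ} (hW : 0 ≤ W) (hA : 0 ≤ A)
    (hwin : ∀ (τ : ℝ) (P : Finset ℂ), (∀ ρ ∈ P, f ρ = 0 ∧ 0 < ρ.re ∧ ρ.re < 1 ∧ |ρ.im - τ| ≤ 1 / 2) →
      ∑ ρ ∈ P, (analyticOrderNatAt f ρ : ℝ) ≤ W * (A + Real.log (|τ| + 4))) {T : ℝ} (hT : 1 ≤ T) :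
    Summable (fun ρ : nontrivialZeros f ↦
        (if T ≤ |(ρ : ℂ).im| then (analyticOrderNatAt f (ρ : ℂ) : ℝ) / ‖(ρ : ℂ)‖ ^ 2 else 0)) ∧
      ∑' ρ : nontrivialZeros f,
        (if T ≤ |(ρ : ℂ).im| then (analyticOrderNatAt f (ρ : ℂ) : ℝ) / ‖(ρ : ℂ)‖ ^ 2 else 0) ≤
          T ^ (-((1 : ℝ) / 2)) * (W * (tailConst₁ * A + tailConst₂)) := by
  obtain ⟨hsum, hle⟩ := summable_indicator_mul_rpow hW hA hwin
  set G : nontrivialZeros f → ℝ := fun ρ ↦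
    if T ≤ |(ρ : ℂ).im| then (analyticOrderNatAt f (ρ : ℂ) : ℝ) / ‖(ρ : ℂ)‖ ^ 2 else 0 with hG
  set F : nontrivialZeros f → ℝ := fun ρ ↦
    if 1 ≤ |(ρ : ℂ).im| then (analyticOrderNatAt f (ρ : ℂ) : ℝ) * |(ρ : ℂ).im| ^ (-((3 : ℝ) / 2)) else 0 with hF
  have hT0 : 0 < T := by linarith
  have hpt : ∀ ρ, G ρ ≤ T ^ (-((1 : ℝ) / 2)) * F ρ := by
    intro ρ
    rw [hG, hF]; dsimp only
    by_cases h : T ≤ |(ρ : ℂ).im|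
    · have h1 : 1 ≤ |(ρ : ℂ).im| := hT.trans h
      rw [if_pos h, if_pos h1]
      have hγ : 0 < |(ρ : ℂ).im| := by linarith
      have hm : (0 : ℝ) ≤ analyticOrderNatAt f (ρ : ℂ) := Nat.cast_nonneg _
      -- `‖ρ‖² ≥ |γ|² ≥ T^{1/2} |γ|^{3/2}`
      have hnorm : |(ρ : ℂ).im| ^ 2 ≤ ‖(ρ : ℂ)‖ ^ 2 := by
        have := Complex.abs_im_le_norm (ρ : ℂ)
        nlinarith [abs_nonneg ((ρ : ℂ).im)]
      have hsplit : |(ρ : ℂ).im| ^ (2 : ℝ) = |(ρ : ℂ).im| ^ ((1 : ℝ) / 2) * |(ρ : ℂ).im| ^ ((3 : ℝ) / 2) := by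
        rw [← Real.rpow_add hγ]; norm_num
      have hThalf : T ^ ((1 : ℝ) / 2) ≤ |(ρ : ℂ).im| ^ ((1 : ℝ) / 2) := Real.rpow_le_rpow hT0.le h (by norm_num)
      have hkey : T ^ ((1 : ℝ) / 2) * |(ρ : ℂ).im| ^ ((3 : ℝ) / 2) ≤ ‖(ρ : ℂ)‖ ^ 2 := by
        calc T ^ ((1 : ℝ) / 2) * |(ρ : ℂ).im| ^ ((3 : ℝ) / 2) ≤ |(ρ : ℂ).im| ^ ((1 : ℝ) / 2) * |(ρ : ℂ).im| ^ ((3 : ℝ) / 2) :=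
              mul_le_mul_of_nonneg_right hThalf (by positivity)
          _ = |(ρ : ℂ).im| ^ 2 := by rw [← hsplit, Real.rpow_two]
          _ ≤ ‖(ρ : ℂ)‖ ^ 2 := hnorm
      have hpos : 0 < T ^ ((1 : ℝ) / 2) * |(ρ : ℂ).im| ^ ((3 : ℝ) / 2) := by positivity
      calc (analyticOrderNatAt f (ρ : ℂ) : ℝ) / ‖(ρ : ℂ)‖ ^ 2 ≤ (analyticOrderNatAt f (ρ : ℂ) : ℝ) / (T ^ ((1 : ℝ) / 2) * |(ρ : ℂ).im| ^ ((3 : ℝ) / 2)) :=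
            div_le_div_of_nonneg_left hm hpos hkey
        _ = T ^ (-((1 : ℝ) / 2)) * ((analyticOrderNatAt f (ρ : ℂ) : ℝ) * |(ρ : ℂ).im| ^ (-((3 : ℝ) / 2))) := by
            rw [Real.rpow_neg hT0.le, Real.rpow_neg hγ.le]; field_simp
    · rw [if_neg h]
      split_ifs <;> positivity
  have hG0 : ∀ ρ, 0 ≤ G ρ := fun ρ ↦ by rw [hG]; dsimp only; split_ifs <;> positivity
  have hsumG : Summable G := Summable.of_nonneg_of_le hG0 hpt (hsum.mul_left _)
  refine ⟨hsumG, ?_⟩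
  calc ∑' ρ, G ρ ≤ ∑' ρ, T ^ (-((1 : ℝ) / 2)) * F ρ := hsumG.tsum_le_tsum hpt (hsum.mul_left _)
    _ = T ^ (-((1 : ℝ) / 2)) * ∑' ρ, F ρ := tsum_mul_left
    _ ≤ T ^ (-((1 : ℝ) / 2)) * (W * (tailConst₁ * A + tailConst₂)) := mul_le_mul_of_nonneg_left hle (by positivity)

end Literature.NumberTheory.LFunctions.EntireEF

end
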